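/-
Copyright: the b2b-balaban cell (near-miss cell 7), T⁴-continuum fan-out; row NE7b ROUND-2 swarm, seat
t4-ne7b-formalise-leaf-10 (row S7 §0 of `t4/b2b-balaban-t4-ne7b-p1/LEAVES-NE7b.md`, owner's ruling R-OWNER-22-1 R2).
Released under the licence of the surrounding project.
-/
import Summits.QuantumFields.BalabanUV.T4Continuum.Support.HistoryFlow

/-!
# The history socket on the TREE COUNT (socket v3): live families of cell-tagged TAGGED genealogies over the TH exit

Summits-side support leaf of the T⁴-continuum cell (rung (B)+1 on a FINITE torus only; NOT infinite volume, NOT the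
mass gap, NOT the Clay statement; NOT a proof of the spine estimate NE7b).  Row NE7b, route «COUNT», ROUND-2 swarm
claim table `t4/b2b-balaban-t4-ne7b-p1/LEAVES-NE7b.md`, row S7 §0, seat `t4-ne7b-formalise-leaf-10`, by the owner's
ruling R-OWNER-22-1 (R1: the assembly targets the TH exit `CountThresholdExit.relWeightBound_lateMergers_of_irThreshold`
at `D := 0`, `Δ := 1`; R2: this socket).  [folklore] bookkeeping over the lineage's OWN typed carrier; nothing is
quoted from print, nothing printed is asserted, no `[cite:]` tag, no `Prop`-valued fact is minted (trigger c1).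

WHY (the typer's caveat T-NE7b-3(b)(1), in substance).  On the Z-route sockets (`HistorySocket` p206610,
`HistorySocketTagged` p207585) a slot is (root step, root cell, root event, RECORD = event set) and the exit
`relWeightBoundZ_of_irThreshold` prices ONE genealogy per slot, so `price` is realisable for print only together with a
count paying the sum over the COALESCENTS realised on one record (two merge orders `((A·B)·C)`, `((A·C)·B)` are
consistent, well formed, pending on one slot — kernel-decided, `ShapeAmbiguity.lean`∕`W13.lean`), and a genealogy over
`PEv` cannot carry two constituents of one event type (`Gen.WF`).  The lineage's TREE COUNT (the [CONV-D] chain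
`LateMergersCount`∕`T4BranchingRecordsGas` at horizon `D`) has neither defect: its slots `BSlot γ PEv = (j, z, SHAPE
TREE)` carry the cell AND the coalescent, its genealogies are TAGGED (`Gen ε`, shape map `sh : ε → PEv`; tags distinct —
`FreshT` —, shapes free to repeat), and distinct coalescents are distinct slots counted by `famSum_le`.  Hence the
assembly moves to the TH exit; this file is its socket.

WHAT.  §1 `bslotOf sh (z, G′) := ⟨G′.rootStep, z, relabel (shape ∘ sh) G′⟩`, `InLiveTH`, the exit's per-member price
shape `shapeTH` (`Δ·Λ′^{partnerAges}·e^{−credits}·e^{+lifeCost}` over the padded table, VERBATIM the right-hand side of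
the exit's `hlabTH`), `occShapes`∕`yTH` (the labelled price of a branching slot = the MAXIMUM of the shapes of its live
occupants, `sSup`, `0` if none), `bstrOf`, and **`structure LiveHistoriesTH`** — fields per live member `(z, G′)` for
`K ≥ K₀`: `consistent` (`ConsistentTH sh C K (R K) D G′`), `fresh` (`FreshT G′`), `pending` (`K − D < reach` over
`dictWT`), `cell_mem` (`z ∈ Cell K (K − G′.rootStep)`), `canon` (`relabel (shape ∘ sh) G′ ∈ canonFam Dcap Ncap K
G′.rootStep` — the caps and the chronology, via `T4CanonicalMenus.mem_canonFam_of_chrono`), `old`, `slot_inj` WITHIN a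
class (distinct members of ONE class differ in (root step, cell, shape tree) — for one term: disjoint regions), `str_inj`
(classes KEYED by their branching slot families — definitional in the assembly), `price`∕`price′`
(`F·Rf ≤ ∏_{members} shapeTH`).  §2 derived binders: `BadFin`∕`badFin_of_regeneration` (finitely many bad classes per
cutoff, from the exit's own `Regeneration.bad_subset`), `occShapes_finite`, `yTH_nonneg`, `shapeTH_le_yTH`,
**`hlabTH_of_live`**, `hinj_of_live`, **`hstr_of_live`**, `prod_shapeTH_le_famWeight`, **`hF_of_live`**∕`hF'_of_live`.
§3 **`relWeightBound_of_liveHistoriesTH`** = the TH exit with its (ID) binders (`y`∕`hy0`∕`hlabTH`, `str`∕`hinj`∕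
`hstr`, `hF`∕`hF′`) REPLACED by ONE `LiveHistoriesTH`; **`hybridNE7_of_liveHistoriesTH`** (+ NE7c's `ShellWeightBound`,
NE7's `ReindexedBudget`, four summable rates, via `CountSeamJunction.hybridNE7_of_eventually`).  The `_tuned` twins along Bałaban's
tuned runs (flow side from S8 `HistoryFlow`) and the empty-class sanity instance are the companion leaf
`Support/HistorySocketTHTuned`.

ZONE MULTIPLICITIES: the exit's `hlabTH` allows `Δ·Λ′^{partnerAges}` only; the zone factors `Kz^{#merges}·∏Q^p` are
absorbed UPSTREAM into the birth credits (`lowerA C (zoneRate …)`, `PartnerMultiplicityZ.zone_surcharge_le`) — row S6e;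
this socket is parametric in `C` and `Δ ≥ 1`.  NOT DONE HERE: inhabiting `LiveHistoriesTH` for Bałaban's runs (rows
S3–S7∕S6e∕S10∕S12, under the displayed H3 and `RenewAtReach`); (B) via the `Regeneration` binders.  NE7b: no date.

HONEST DEPENDENCY (cell): continuum YM on T⁴ ⇐ BetaPertH ∧ nine spine estimates (0/9 proved); BetaPertH ⇐ (D1) ∧ (D4)
∧ CAP+tail.  This file changes none of it.
-/

open Finset
open Literature.MathematicalPhysics.QuantumFieldTheory.Balaban1983to89
open T4PersistenceDictionary T4PersistentHistoryCount T4BankedInduction T4PrintedShapeBanking T4WeightBudget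
open T4GlobalDenominator T4LiveClassFibration T4LiveStructureGas T4LiveGasToTerms T4RecordPriceSeam T4IndicatorShell
open T4MatchingAssembly T4MatchingClosure T4MatchingClosureSocket T4PartnerMultiplicity T4Continuum
open T4BranchingRecordsGas T4TaggedShapeBanking T4CanonicalMenus T4CountHorizon
open Summit.QuantumFields.BalabanUV.T4Continuum.CountThresholdUniform
open Summit.QuantumFields.BalabanUV.T4Continuum.CountThresholdExit
open Summit.QuantumFields.BalabanUV.T4Continuum.CountSeamJunction
open Summit.QuantumFields.BalabanUV.T4Continuum.LateMergers
open Summit.QuantumFields.BalabanUV.T4Continuum.HistoryFlow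

namespace Summit.QuantumFields.BalabanUV.T4Continuum.HistorySocketTH

noncomputable section

/-! ## §1 Branching slots of tagged members, the exit's price shape, the max-price, the socket -/

section Defs

variable {ε γ κ : Type*}

/-- **THE BRANCHING SLOT OF A CELL-TAGGED TAGGED GENEALOGY** `(z, G′)`: (root step, root cell, SHAPE TREE). [folklore] -/
def bslotOf (sh : ε → PEv) (q : γ × Gen ε) : BSlot γ PEv := ⟨q.2.rootStep, q.1, relabel (shape ∘ sh) q.2⟩

/-- `(z, G′)` is LIVE at cutoff `K`: a member of the live family of some bad class at some source. [folklore] -/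
def InLiveTH (l₀ : ℝ) (Bad' : ℕ → ℝ → Finset κ) (live : ℕ → κ → Finset (γ × Gen ε)) (K : ℕ) (q : γ × Gen ε) :
    Prop :=
  ∃ t : ℝ, |t| ≤ l₀ ∧ ∃ c ∈ Bad' K t, q ∈ live K c

variable [DecidableEq ε]

/-- **THE EXIT'S PER-MEMBER PRICE SHAPE** — the right-hand side of `relWeightBound_lateMergers_of_irThreshold`'s `hlabTH`
verbatim: `Δ·Λ′^{partnerAges}·e^{−credits}·e^{+lifeCost}` (credits and costs read through the shape map, life over the
`D`-padded table). [folklore] -/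
def shapeTH (sh : ε → PEv) (C : T4PrintedShapeBanking.Consts) (Λ' Δ : ℝ) (R : ℕ → ℕ → ℕ) (g : ℕ → ℕ → ℝ) (D K : ℕ)
    (G : Gen ε) : ℝ :=
  Δ * (Λ' ^ partnerAges (PEv.step ∘ sh) G * (Real.exp (-credits (credit C (g K) ∘ sh) G) *
    Real.exp (lifeCost (padW (dictWT sh (R K) C.n₁) D) (costT sh C K (R K)) G)))

/-- the price shape is nonnegative (`Δ ≥ 0`, `Λ′ ≥ 0`) [folklore] -/
theorem shapeTH_nonneg {sh : ε → PEv} {C : T4PrintedShapeBanking.Consts} {Λ' Δ : ℝ} (hΔ : 0 ≤ Δ) (hΛ : 0 ≤ Λ')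
    (R : ℕ → ℕ → ℕ) (g : ℕ → ℕ → ℝ) (D K : ℕ) (G : Gen ε) : 0 ≤ shapeTH sh C Λ' Δ R g D K G := by
  unfold shapeTH; positivity

/-- the price shapes of the live occupants of a branching slot at cutoff `K` [folklore] -/
def occShapes (sh : ε → PEv) (C : T4PrintedShapeBanking.Consts) (Λ' Δ l₀ : ℝ) (R : ℕ → ℕ → ℕ) (g : ℕ → ℕ → ℝ)
    (D : ℕ) (Bad' : ℕ → ℝ → Finset κ) (live : ℕ → κ → Finset (γ × Gen ε)) (K : ℕ) (s : BSlot γ PEv) : Set ℝ :=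
  {x | ∃ q : γ × Gen ε, InLiveTH l₀ Bad' live K q ∧ bslotOf sh q = s ∧ x = shapeTH sh C Λ' Δ R g D K q.2}

/-- **THE LABELLED PRICE OF A BRANCHING SLOT (max-price)**: the largest price shape of a live occupant, `0` if none
(`sSup` of `{0} ∪` the occupants' shapes; finite whenever the cutoff has finitely many bad classes). [folklore] -/
def yTH (sh : ε → PEv) (C : T4PrintedShapeBanking.Consts) (Λ' Δ l₀ : ℝ) (R : ℕ → ℕ → ℕ) (g : ℕ → ℕ → ℝ) (D : ℕ)
    (Bad' : ℕ → ℝ → Finset κ) (live : ℕ → κ → Finset (γ × Gen ε)) (K j : ℕ) (z : γ) (G : Gen PEv) : ℝ :=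
  sSup (insert 0 (occShapes sh C Λ' Δ l₀ R g D Bad' live K ⟨j, z, G⟩))

variable [DecidableEq γ]

/-- **THE BRANCHING SLOT FAMILY OF A CLASS**: the branching slots of its live members. [folklore] -/
def bstrOf (sh : ε → PEv) (live : ℕ → κ → Finset (γ × Gen ε)) (K : ℕ) (c : κ) : Finset (BSlot γ PEv) :=
  (live K c).image (bslotOf sh)

/-- **THE HISTORY SOCKET ON THE TREE COUNT.**  Data: per cutoff `K` and class `c` the finite set `live K c` of LIVE
MEMBERS `(root cell, tagged genealogy)`.  Obligations for `K ≥ K₀`: per member — consistency (late mergers up to `D`),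
fresh tags, pending past `K − D`, root cell of the root's age, shape tree in the canonical run family (caps +
chronology); per class — an OLD member, slot-injectivity WITHIN the class, the class price (both runs) dominated by the
product of the members' shapes; across classes — separation by branching slot families. [folklore] -/
structure LiveHistoriesTH (sh : ε → PEv) (C : T4PrintedShapeBanking.Consts) (Λ' Δ : ℝ) (l₀ : ℝ) (K₀ : ℕ)
    (R : ℕ → ℕ → ℕ) (g : ℕ → ℕ → ℝ) (Cell : ℕ → ℕ → Finset γ) (Dcap Ncap : ℕ → ℕ) (jstar : ℕ → ℕ) (D : ℕ)
    (Bad' : ℕ → ℝ → Finset κ) (F Rf F' Rf' : ℕ → κ → ℝ) (live : ℕ → κ → Finset (γ × Gen ε)) : Prop where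
  /-- (H2b) live members are consistent at their cutoff (late mergers up to the horizon `D`) -/
  consistent : ∀ K q, K₀ ≤ K → InLiveTH l₀ Bad' live K q → ConsistentTH sh C K (R K) D q.2
  /-- (H2b) … their tags are fresh -/
  fresh : ∀ K q, K₀ ≤ K → InLiveTH l₀ Bad' live K q → FreshT q.2
  /-- (H2b) … and they are pending past `K − D` -/
  pending : ∀ K q, K₀ ≤ K → InLiveTH l₀ Bad' live K q → K - D < q.2.reach (dictWT sh (R K) C.n₁)
  /-- (H2e) the root cell is a cell of the root's age -/
  cell_mem : ∀ K q, K₀ ≤ K → InLiveTH l₀ Bad' live K q → q.1 ∈ Cell K (K - q.2.rootStep)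
  /-- (H2e) the shape tree is a record of the canonical run of its slot (caps and chronology) -/
  canon : ∀ K q, K₀ ≤ K → InLiveTH l₀ Bad' live K q → relabel (shape ∘ sh) q.2 ∈ canonFam Dcap Ncap K q.2.rootStep
  /-- (H2e) every bad class has an OLD live member (born before the matching scale) -/
  old : ∀ K t, |t| ≤ l₀ → K₀ ≤ K → ∀ c ∈ Bad' K t, ∃ q ∈ live K c, q.2.rootStep < jstar K
  /-- (H2e) WITHIN a class, distinct live members occupy distinct branching slots -/
  slot_inj : ∀ K t, |t| ≤ l₀ → K₀ ≤ K → ∀ c ∈ Bad' K t, Set.InjOn (bslotOf sh) (live K c : Set (γ × Gen ε))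
  /-- (H2e) distinct bad classes have distinct branching slot families -/
  str_inj : ∀ K t, |t| ≤ l₀ → K₀ ≤ K → Set.InjOn (bstrOf sh live K) (Bad' K t)
  /-- (P) run A: the class price is dominated by the product of the members' price shapes -/
  price : ∀ K t, |t| ≤ l₀ → K₀ ≤ K → ∀ c ∈ Bad' K t,
    F K c * Rf K c ≤ ∏ q ∈ live K c, shapeTH sh C Λ' Δ R g D K q.2
  /-- (P) run A′: the same -/
  price' : ∀ K t, |t| ≤ l₀ → K₀ ≤ K → ∀ c ∈ Bad' K t,
    F' K c * Rf' K c ≤ ∏ q ∈ live K c, shapeTH sh C Λ' Δ R g D K q.2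

end Defs

/-! ## §2 The (ID) binders of the TH exit, DERIVED from the socket -/

section Derived

variable {ε γ κ : Type*} [DecidableEq ε] {sh : ε → PEv} {C : T4PrintedShapeBanking.Consts} {Λ' Δ l₀ : ℝ} {K₀ : ℕ}
  {R : ℕ → ℕ → ℕ} {g : ℕ → ℕ → ℝ} {Cell : ℕ → ℕ → Finset γ} {Dcap Ncap : ℕ → ℕ} {jstar : ℕ → ℕ} {D : ℕ}
  {Bad' : ℕ → ℝ → Finset κ} {F Rf F' Rf' : ℕ → κ → ℝ} {live : ℕ → κ → Finset (γ × Gen ε)}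

/-- **FINITELY MANY BAD CLASSES AT A CUTOFF** (all sources `|t| ≤ l₀` at once). [folklore] -/
def BadFin (l₀ : ℝ) (Bad' : ℕ → ℝ → Finset κ) (K : ℕ) : Prop := ∃ Bs : Finset κ, ∀ t, |t| ≤ l₀ → Bad' K t ⊆ Bs

/-- the exit's own `Regeneration` binder supplies `BadFin` from `K₀` on (`Bs = classIndex π T K`). [folklore] -/
theorem badFin_of_regeneration {ι : Type*} [DecidableEq κ] {π : ℕ → ι → κ} {T : ℕ → Finset ι}
    {A dead : ℕ → ℝ → ι → ℝ} {nlow nup : ℕ → ℝ → ℝ} {Cn : ℝ}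
    (hA : Regeneration l₀ π T A Bad' dead F Rf nlow nup Cn K₀) {K : ℕ} (hK : K₀ ≤ K) : BadFin l₀ Bad' K :=
  ⟨classIndex π T K, fun t ht => hA.bad_subset K t ht hK⟩

omit [DecidableEq ε] in
/-- a consistent genealogy (late mergers allowed) is born by the cutoff [folklore] -/
theorem rootStep_le_of_consistentTH {K : ℕ} :
    ∀ {G : Gen ε}, ConsistentTH sh C K (R K) D G → G.rootStep ≤ K
  | Gen.born _ _, hc => by simp only [ConsistentTH] at hc; simpa using hc.2.2
  | Gen.renew G _ _, hc => by
      simp only [ConsistentTH] at hc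
      simpa using rootStep_le_of_consistentTH hc.1
  | Gen.merge X Y _, hc => by
      simp only [ConsistentTH] at hc
      simp only [Gen.rootStep_merge]
      exact (min_le_left _ _).trans (rootStep_le_of_consistentTH hc.1)

/-- with finitely many bad classes, a branching slot has finitely many occupant shapes [folklore] -/
theorem occShapes_finite {K : ℕ} (hfin : BadFin l₀ Bad' K) (s : BSlot γ PEv) :
    (occShapes sh C Λ' Δ l₀ R g D Bad' live K s).Finite := by
  obtain ⟨Bs, hBs⟩ := hfin
  have hU : (⋃ c ∈ (Bs : Set κ), (live K c : Set (γ × Gen ε))).Finite :=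
    Bs.finite_toSet.biUnion fun c _ => (live K c).finite_toSet
  refine ((hU.image fun q : γ × Gen ε => shapeTH sh C Λ' Δ R g D K q.2).subset ?_)
  rintro x ⟨q, ⟨t, ht, c, hc, hq⟩, -, rfl⟩
  exact ⟨q, Set.mem_iUnion₂.2 ⟨c, hBs t ht hc, hq⟩, rfl⟩

/-- the labelled price is nonnegative (every cutoff) [folklore] -/
theorem yTH_nonneg (K j : ℕ) (z : γ) (G : Gen PEv) : 0 ≤ yTH sh C Λ' Δ l₀ R g D Bad' live K j z G := by
  unfold yTH
  by_cases h : BddAbove (insert 0 (occShapes sh C Λ' Δ l₀ R g D Bad' live K ⟨j, z, G⟩))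
  · exact le_csSup h (Set.mem_insert _ _)
  · rw [Real.sSup_of_not_bddAbove h]

/-- **A LIVE OCCUPANT'S SHAPE IS AT MOST ITS SLOT'S PRICE.** [folklore] -/
theorem shapeTH_le_yTH {K : ℕ} (hfin : BadFin l₀ Bad' K) {q : γ × Gen ε} (hq : InLiveTH l₀ Bad' live K q) :
    shapeTH sh C Λ' Δ R g D K q.2 ≤ yTH sh C Λ' Δ l₀ R g D Bad' live K q.2.rootStep q.1 (relabel (shape ∘ sh) q.2) :=
  le_csSup ((occShapes_finite hfin _).insert 0).bddAbove (Set.mem_insert_of_mem _ ⟨q, hq, rfl, rfl⟩)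

/-- **THE SUPPLIERS' TOOL**: a slot-injective finite family of live members has product of shapes at most the family
weight of its slot image (`Δ ≥ 0`, `Λ′ ≥ 0`). [folklore] -/
theorem prod_shapeTH_le_famWeight [DecidableEq γ] (hΔ : 0 ≤ Δ) (hΛ : 0 ≤ Λ') {K : ℕ} (hfin : BadFin l₀ Bad' K)
    {S : Finset (γ × Gen ε)} (hS : ∀ q ∈ S, InLiveTH l₀ Bad' live K q)
    (hinj : Set.InjOn (bslotOf sh) (S : Set (γ × Gen ε))) :
    ∏ q ∈ S, shapeTH sh C Λ' Δ R g D K q.2 ≤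
      famWeight (bslotPrice (yTH sh C Λ' Δ l₀ R g D Bad' live K)) (S.image (bslotOf sh)) := by
  rw [famWeight, prod_image hinj]
  refine prod_le_prod (fun q _ => shapeTH_nonneg hΔ hΛ R g D K _) fun q hq => ?_
  simp only [bslotOf, bslotPrice]
  exact shapeTH_le_yTH hfin (hS q hq)

variable [DecidableEq γ]

/-- **`hlabTH` FROM THE SOCKET**: at every branching slot the price is `≤ 0` or the shape of a live member — consistent,
fresh, pending, of that shape tree — an arg-max occupant. [folklore] -/
theorem hlabTH_of_live
    (H : LiveHistoriesTH sh C Λ' Δ l₀ K₀ R g Cell Dcap Ncap jstar D Bad' F Rf F' Rf' live)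
    (hfin : ∀ K, K₀ ≤ K → BadFin l₀ Bad' K)
    (K : ℕ) (hK : K₀ ≤ K) (j : ℕ) (_hj : j ≤ K) (z : γ) (_hz : z ∈ Cell K (K - j)) (G : Gen PEv)
    (_hG : G ∈ canonFam Dcap Ncap K j) :
    yTH sh C Λ' Δ l₀ R g D Bad' live K j z G ≤ 0 ∨
      ∃ G' : Gen ε, ConsistentTH sh C K (R K) D G' ∧ FreshT G' ∧
        K - D < G'.reach (dictWT sh (R K) C.n₁) ∧ relabel (shape ∘ sh) G' = G ∧
        yTH sh C Λ' Δ l₀ R g D Bad' live K j z G ≤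
          Δ * (Λ' ^ partnerAges (PEv.step ∘ sh) G' * (Real.exp (-credits (credit C (g K) ∘ sh) G') *
            Real.exp (lifeCost (padW (dictWT sh (R K) C.n₁) D) (costT sh C K (R K)) G'))) := by
  have hne : (insert (0 : ℝ) (occShapes sh C Λ' Δ l₀ R g D Bad' live K ⟨j, z, G⟩)).Nonempty :=
    ⟨0, Set.mem_insert _ _⟩
  have hmem := hne.csSup_mem ((occShapes_finite (hfin K hK) _).insert 0)
  rcases Set.mem_insert_iff.1 hmem with h0 | hS
  · left
    unfold yTH
    exact le_of_eq h0
  · right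
    obtain ⟨q, hin, hslot, hx⟩ := hS
    simp only [bslotOf, Sigma.mk.inj_iff, heq_eq_eq] at hslot
    obtain ⟨rfl, rfl, rfl⟩ := hslot
    refine ⟨q.2, H.consistent K q hK hin, H.fresh K q hK hin, H.pending K q hK hin, rfl, ?_⟩
    unfold yTH
    rw [hx]
    exact le_of_eq rfl

/-- **`hinj` FROM THE SOCKET** (the field `str_inj`). [folklore] -/
theorem hinj_of_live (H : LiveHistoriesTH sh C Λ' Δ l₀ K₀ R g Cell Dcap Ncap jstar D Bad' F Rf F' Rf' live)
    (K : ℕ) (t : ℝ) (ht : |t| ≤ l₀) (hK : K₀ ≤ K) : Set.InjOn (bstrOf sh live K) (Bad' K t) :=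
  H.str_inj K t ht hK

/-- **`hstr` FROM THE SOCKET**: the branching slot family of a bad class consists of LIVE branching slots and contains an
OLD one. [folklore] -/
theorem hstr_of_live (H : LiveHistoriesTH sh C Λ' Δ l₀ K₀ R g Cell Dcap Ncap jstar D Bad' F Rf F' Rf' live)
    (K : ℕ) (t : ℝ) (ht : |t| ≤ l₀) (hK : K₀ ≤ K) :
    ∀ c ∈ Bad' K t, bstrOf sh live K c ⊆ bliveSlots Cell (canonFam Dcap Ncap) K ∧
      ∃ o ∈ boldSlots Cell (canonFam Dcap Ncap) jstar K, o ∈ bstrOf sh live K c := by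
  intro c hc
  refine ⟨fun s hs => ?_, ?_⟩
  · obtain ⟨q, hq, rfl⟩ := mem_image.1 hs
    have hin : InLiveTH l₀ Bad' live K q := ⟨t, ht, c, hc, hq⟩
    simp only [bliveSlots, bslotOf, mem_sigma, mem_range]
    exact ⟨Nat.lt_succ_of_le (rootStep_le_of_consistentTH (H.consistent K q hK hin)), H.cell_mem K q hK hin,
      H.canon K q hK hin⟩
  · obtain ⟨q, hq, hold⟩ := H.old K t ht hK c hc
    have hin : InLiveTH l₀ Bad' live K q := ⟨t, ht, c, hc, hq⟩
    refine ⟨bslotOf sh q, ?_, mem_image_of_mem _ hq⟩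
    simp only [boldSlots, bslotOf, mem_sigma, mem_range]
    exact ⟨hold, H.cell_mem K q hK hin, H.canon K q hK hin⟩

/-- **`hF` FROM THE SOCKET**: the class price is dominated by the family weight of its branching slot family at the
max-price (`price`, then `prod_shapeTH_le_famWeight` on the class). [folklore] -/
theorem hF_of_live (hΔ : 0 ≤ Δ) (hΛ : 0 ≤ Λ')
    (H : LiveHistoriesTH sh C Λ' Δ l₀ K₀ R g Cell Dcap Ncap jstar D Bad' F Rf F' Rf' live)
    {K : ℕ} (hfin : BadFin l₀ Bad' K) (t : ℝ) (ht : |t| ≤ l₀) (hK : K₀ ≤ K) :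
    ∀ c ∈ Bad' K t, F K c * Rf K c ≤ famWeight (bslotPrice (yTH sh C Λ' Δ l₀ R g D Bad' live K)) (bstrOf sh live K c) :=
  fun c hc => (H.price K t ht hK c hc).trans
    (prod_shapeTH_le_famWeight hΔ hΛ hfin (fun _ hq => ⟨t, ht, c, hc, hq⟩) (H.slot_inj K t ht hK c hc))

/-- … and `hF′`. [folklore] -/
theorem hF'_of_live (hΔ : 0 ≤ Δ) (hΛ : 0 ≤ Λ')
    (H : LiveHistoriesTH sh C Λ' Δ l₀ K₀ R g Cell Dcap Ncap jstar D Bad' F Rf F' Rf' live)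
    {K : ℕ} (hfin : BadFin l₀ Bad' K) (t : ℝ) (ht : |t| ≤ l₀) (hK : K₀ ≤ K) :
    ∀ c ∈ Bad' K t,
      F' K c * Rf' K c ≤ famWeight (bslotPrice (yTH sh C Λ' Δ l₀ R g D Bad' live K)) (bstrOf sh live K c) :=
  fun c hc => (H.price' K t ht hK c hc).trans
    (prod_shapeTH_le_famWeight hΔ hΛ hfin (fun _ hq => ⟨t, ht, c, hc, hq⟩) (H.slot_inj K t ht hK c hc))

end Derived

/-! ## §3 The TH exit and the seam over the socket -/

section Exit

variable {ε γ κ ι : Type*} [DecidableEq ε] [DecidableEq γ] [DecidableEq κ] [DecidableEq ι] {l₀ vol : ℝ} {K₀ : ℕ}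
  {π : ℕ → ι → κ} {T : ℕ → Finset ι} {A A' shA shB : ℕ → ℝ → ι → ℝ} {Bad' : ℕ → ℝ → Finset κ}
  {dead dead' : ℕ → ℝ → ι → ℝ} {F Rf F' Rf' : ℕ → κ → ℝ} {nlow nup mlow mup : ℕ → ℝ → ℝ} {Cn : ℝ}
  {Cc Rr CcRec RrRec : ℕ → ℝ → ι → ℝ} {ν u s₂ c₀ r s Wsh : ℕ → ℝ}

omit [DecidableEq ι] in
/-- **NE7b's TREE-COUNT EXIT OVER THE SOCKET.**  `CountThresholdExit.relWeightBound_lateMergers_of_irThreshold` with its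
(ID) binders (`y`∕`hy0`∕`hlabTH`, `str`∕`hinj`∕`hstr`, `hF`, `hF′`) REPLACED by ONE `LiveHistoriesTH` hypothesis (the
finiteness behind the max-price comes from `hA.bad_subset`); every other binder verbatim; conclusion unchanged.
[folklore] -/
theorem relWeightBound_of_liveHistoriesTH (sh : ε → PEv) {C : T4PrintedShapeBanking.Consts} {L rr : ℕ} {β₀ : ℝ}
    (h : ThresholdOK C L rr β₀) (hμ₀ : 0 < C.μ)
    (Cell : ℕ → ℕ → Finset γ) {V Λ : ℝ} (hV : 0 ≤ V) (hΛ : 0 < Λ)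
    (hcell : ∀ K a, ((Cell K a).card : ℝ) ≤ V * Λ ^ a) (Dcap Ncap : ℕ → ℕ)
    (jstar : ℕ → ℕ) (hj : ∀ K, jstar K ≤ K) {c : ℝ} (hc : 0 < c)
    (hfrac : ∀ K : ℕ, c * K ≤ ((K - jstar K : ℕ) : ℝ)) (D : ℕ) {Δ : ℝ} (hΔ : 1 ≤ Δ)
    (hA : Regeneration l₀ π T A Bad' dead F Rf nlow nup Cn K₀)
    (hA' : Regeneration l₀ π T A' Bad' dead' F' Rf' mlow mup Cn K₀) (hCn : 0 ≤ Cn)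
    (R : ℕ → ℕ → ℕ) (g : ℕ → ℕ → ℝ) (β' : ℕ → ℝ)
    (h27 : ∀ K, K₀ ≤ K → B14.FlowIneq27 (g K) (β' K) β₀ C.p₀ K)
    (h29 : ∀ K, K₀ ≤ K → B14FlowStep.FlowIneq29 (R K) (g K) L (β' K) β₀ K)
    (hR : ∀ K, K₀ ≤ K → ∀ s, s ≤ K → B14.IsRj L rr (g K s) (R K s))
    (hx1 : ∀ K, K₀ ≤ K → ∀ s, s ≤ K → 1 ≤ Real.log ((g K s) ^ 2)⁻¹)
    (hir : ∀ K, K₀ ≤ K → irThresholdTH sh C L rr β₀ D ≤ Real.log ((g K K) ^ 2)⁻¹)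
    (hP : ∀ K s, 0 ≤ p0Profile C.A₀ C.p₀ (g K s))
    {ηplus : ℝ} (hηplus : 0 ≤ ηplus) (hr : Λ * Real.exp (ηplus - C.κ₁) < 1)
    {Λ' : ℝ} (hΛ0 : 0 ≤ Λ') (h1 : Λ' * Real.exp (-C.κ₁) * Real.exp ηplus < 1)
    (hx : (Real.exp (-C.E₀) + Real.exp (-C.E₀) * birthMass C *
          (Λ' * Real.exp (-C.κ₁) / (1 - Λ' * Real.exp (-C.κ₁) * Real.exp ηplus))) * Real.exp ηplus ≤
        Real.exp ηplus - 1)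
    {live : ℕ → κ → Finset (γ × Gen ε)}
    (H : LiveHistoriesTH sh C Λ' Δ l₀ K₀ R g Cell Dcap Ncap jstar D Bad' F Rf F' Rf' live) :
    ∃ K₁, K₀ ≤ K₁ ∧ RelWeightBound l₀ T A A' (fun K t => if K₁ ≤ K then badOfClass π T Bad' K t else ∅)
      (Set.indicator {K | K₁ ≤ K}
        (fun K => Cn * recordsBudget (Δ * Real.exp (C.κ₁ * (D : ℝ)) * birthMass C) C.κ₁ V Λ ηplus jstar K)) :=
  have hΔ0 : (0 : ℝ) ≤ Δ := zero_le_one.trans hΔ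
  relWeightBound_lateMergers_of_irThreshold sh h hμ₀ Cell hV hΛ hcell Dcap Ncap jstar hj hc hfrac D hΔ hA hA' hCn
    R g β' h27 h29 hR hx1 hir hP hηplus hr hΛ0 h1 hx (yTH sh C Λ' Δ l₀ R g D Bad' live)
    (fun K j _ z _ G _ => yTH_nonneg K j z G) (hlabTH_of_live H fun _ hK => badFin_of_regeneration hA hK)
    (bstrOf sh live) (hinj_of_live H) (hstr_of_live H)
    (fun _ t ht hK => hF_of_live hΔ0 hΛ0 H (badFin_of_regeneration hA hK) t ht hK)
    (fun _ t ht hK => hF'_of_live hΔ0 hΛ0 H (badFin_of_regeneration hA hK) t ht hK)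

/-- **… AND INTO THE SEAM** (`CountSeamJunction.hybridNE7_of_eventually`): + NE7c's `ShellWeightBound`, NE7's
`ReindexedBudget`, four summable rates ⇒ `HybridNE7` for the shifted families. [folklore] -/
theorem hybridNE7_of_liveHistoriesTH (sh : ε → PEv) {C : T4PrintedShapeBanking.Consts} {L rr : ℕ} {β₀ : ℝ}
    (h : ThresholdOK C L rr β₀) (hμ₀ : 0 < C.μ)
    (Cell : ℕ → ℕ → Finset γ) {V Λ : ℝ} (hV : 0 ≤ V) (hΛ : 0 < Λ)
    (hcell : ∀ K a, ((Cell K a).card : ℝ) ≤ V * Λ ^ a) (Dcap Ncap : ℕ → ℕ)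
    (jstar : ℕ → ℕ) (hj : ∀ K, jstar K ≤ K) {c : ℝ} (hc : 0 < c)
    (hfrac : ∀ K : ℕ, c * K ≤ ((K - jstar K : ℕ) : ℝ)) (D : ℕ) {Δ : ℝ} (hΔ : 1 ≤ Δ)
    (hA : Regeneration l₀ π T A Bad' dead F Rf nlow nup Cn K₀)
    (hA' : Regeneration l₀ π T A' Bad' dead' F' Rf' mlow mup Cn K₀) (hCn : 0 ≤ Cn)
    (R : ℕ → ℕ → ℕ) (g : ℕ → ℕ → ℝ) (β' : ℕ → ℝ)
    (h27 : ∀ K, K₀ ≤ K → B14.FlowIneq27 (g K) (β' K) β₀ C.p₀ K)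
    (h29 : ∀ K, K₀ ≤ K → B14FlowStep.FlowIneq29 (R K) (g K) L (β' K) β₀ K)
    (hR : ∀ K, K₀ ≤ K → ∀ s, s ≤ K → B14.IsRj L rr (g K s) (R K s))
    (hx1 : ∀ K, K₀ ≤ K → ∀ s, s ≤ K → 1 ≤ Real.log ((g K s) ^ 2)⁻¹)
    (hir : ∀ K, K₀ ≤ K → irThresholdTH sh C L rr β₀ D ≤ Real.log ((g K K) ^ 2)⁻¹)
    (hP : ∀ K s, 0 ≤ p0Profile C.A₀ C.p₀ (g K s))
    {ηplus : ℝ} (hηplus : 0 ≤ ηplus) (hr : Λ * Real.exp (ηplus - C.κ₁) < 1)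
    {Λ' : ℝ} (hΛ0 : 0 ≤ Λ') (h1 : Λ' * Real.exp (-C.κ₁) * Real.exp ηplus < 1)
    (hx : (Real.exp (-C.E₀) + Real.exp (-C.E₀) * birthMass C *
          (Λ' * Real.exp (-C.κ₁) / (1 - Λ' * Real.exp (-C.κ₁) * Real.exp ηplus))) * Real.exp ηplus ≤
        Real.exp ηplus - 1)
    {live : ℕ → κ → Finset (γ × Gen ε)}
    (H : LiveHistoriesTH sh C Λ' Δ l₀ K₀ R g Cell Dcap Ncap jstar D Bad' F Rf F' Rf' live)
    (hSh : ShellWeightBound l₀ T A A' shA shB Wsh)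
    (hTB : ReindexedBudget l₀ vol T (fun K t τ => A K t τ - shA K t τ) (fun K t τ => A' K t τ - shB K t τ)
      (badOfClass π T Bad') Cc Rr CcRec RrRec ν u s₂ c₀ r s)
    (hrs : Summable r) (hu : Summable u) (hs : Summable s) (hs₂ : Summable s₂) :
    ∃ K₁ K₂, K₀ ≤ K₁ ∧ HybridNE7 l₀ vol (fun K => T (K₁ + (K₂ + K))) (fun K => A (K₁ + (K₂ + K)))
      (fun K => A' (K₁ + (K₂ + K))) (fun K => badOfClass π T Bad' (K₁ + (K₂ + K)))
      (fun K => Cn * recordsBudget (Δ * Real.exp (C.κ₁ * (D : ℝ)) * birthMass C) C.κ₁ V Λ ηplus jstar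
        (K₁ + (K₂ + K)))
      (fun K => shA (K₁ + (K₂ + K))) (fun K => shB (K₁ + (K₂ + K))) (fun K => Wsh (K₁ + (K₂ + K)))
      (fun K => (r (K₁ + (K₂ + K)) + u (K₁ + (K₂ + K))) + (s (K₁ + (K₂ + K)) + s₂ (K₁ + (K₂ + K)))) :=
  hybridNE7_of_eventually
    (relWeightBound_of_liveHistoriesTH sh h hμ₀ Cell hV hΛ hcell Dcap Ncap jstar hj hc hfrac D hΔ hA hA' hCn R g β'
      h27 h29 hR hx1 hir hP hηplus hr hΛ0 h1 hx H)
    hSh hTB hrs hu hs hs₂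

end Exit

end

end Summit.QuantumFields.BalabanUV.T4Continuum.HistorySocketTH
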